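import Literature.NumberTheory.Automorphic.OrbitalIntegralFixedPointWeighted   -- ★ p843030 (this seat): `integral_conj_eq_smul_finsum_fixedBy{,_of_isClosed}`, the weighted fixed-point unfolding
import HarnessLib

/-!
# The DEPTH EXPANSION of a weighted orbital integral at a compact centraliser — LAYER 1 (generic regrouping):
# `∫_G f(h γ h⁻¹) dν(h) = ν(K) · ( #{q ∈ Fix_γ : depth q ≥ m} · w(m) + Σ_{i<m} #{q ∈ Fix_γ : depth q = i} · w(i) )`
# whenever the value `f(q.out⁻¹ γ q.out)` at a fixed point depends only on `min (depth q) m`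
(Rogawski (1990), §4.9 p. 54; Laumon (1996), Lemma (5.3.2): the fixed-point form of an orbital integral, regrouped by an invariant of the fixed point)

Topic `NumberTheory/Automorphic` (generic layer; the road-specific LAYER 2 is `Rogawski1990/RankOneKappaOrbitalDepthExpansion`); namespace
`Literature.NumberTheory.Automorphic` (that of ★ `OrbitalIntegralFixedPointWeighted`).  THEOREMS ONLY
(no definition, no instance, no notation, no named fact, no `sorry`).  Cell `pub/hodgecm-mathlib`, crux H413 = stmt-HodgeConjecture-24833, road «R1LL-tree» (in-house
pay-down of the rank-one unstable transfer letter at an inert place), brick (α) of architect A-p16 (g27) RULING A-6 (c): B-p12 (g29) census 86286e4d §4 display 1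
  `Φ(⟦t⟧_e, f) = ν(K)·[ φ_m · #{depth ≥ m} + Σ_{i<m} #{depth = i} · φ_i ]`
in TWO layers — THIS FILE is LAYER 1, the pure regrouping over the ★ fixed-point unfolding (p843030) with the DEPTH `d : G ⧸ K → ℕ` and the VALUE LAW
`f(q.out⁻¹ γ q.out) = w (min (d q) m)` ABSTRACT; LAYER 2 (same road) instantiates `d` through the lattice dictionary (★ `FixedCosetsStableLattices`, depth of the
`t`-stable lattice), discharges the value law from B-p12's LEMMA U (the local class at a fixed vertex depends only on the depth) + `Ad K`- and right-`K_m`-invariance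
of the test function, and rewrites the two counts as A-p13 (g31)'s ★ p843015 lattice counts.  Seat F0P2-p01 (g10).
HONEST LABEL: HC_CM is proved only modulo the printed citations until rung 0 closes; this file is generic bookkeeping and asserts nothing printed.

* §1 `finsum_mem_eq_ncard_smul_add_sum_ncard_smul` — for a finite set `S`, `val q = w (min (d q) m)` on `S` ⇒
  `∑ᶠ q ∈ S, val q = #{q ∈ S | m ≤ d q} • w m + Σ_{i<m} #{q ∈ S | d q = i} • w i` (any `AddCommMonoid`).
* §2 **`integral_conj_eq_smul_depthExpansion`** (+ `…_of_isClosed` at a closed class with compact centraliser) — the orbital form over ★ p843030.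

## References
* [Rogawski1990] J. D. Rogawski, *Automorphic Representations of Unitary Groups in Three Variables*, Ann. of Math. Stud. 123 (1990): §4.9 p. 54.
* [Laumon1995] G. Laumon, *Cohomology of Drinfeld Modular Varieties* I (1996): Lemma (5.3.2) p. 136.
* [Kottwitz1986] R. E. Kottwitz, Compositio Math. 60 (1986): §3.
-/

set_option autoImplicit false

noncomputable section

open MeasureTheory Measure Topology Filter Set Function
open scoped ENNReal NNReal Pointwise

namespace Literature.NumberTheory.Automorphic

/-! ## §1 Regrouping a finite sum by a truncated `ℕ`-valued invariant -/

section Regroup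

variable {α : Type*} {E : Type*} [AddCommMonoid E]

/-- **Regrouping by `min (d q) m`**: if on a finite set `S` the summand `val q` depends only on `min (d q) m` through `w`, then
`∑ᶠ q ∈ S, val q = #{q ∈ S | m ≤ d q} • w m + Σ_{i<m} #{q ∈ S | d q = i} • w i` (`#` = `Set.ncard`).  Pure bookkeeping (`Finset.sum_fiberwise_of_maps_to`
on `q ↦ min (d q) m ∈ range (m+1)`). [cite: Laumon1995, Lemma (5.3.2) p. 136] -/
theorem finsum_mem_eq_ncard_smul_add_sum_ncard_smul {S : Set α} (hS : S.Finite) (val : α → E) (d : α → ℕ) (m : ℕ) (w : ℕ → E)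
    (hval : ∀ q ∈ S, val q = w (min (d q) m)) :
    ∑ᶠ q ∈ S, val q = {q ∈ S | m ≤ d q}.ncard • w m + ∑ i ∈ Finset.range m, {q ∈ S | d q = i}.ncard • w i := by
  classical
  -- the fibres of `q ↦ min (d q) m` as `ncard`s
  have hfib : ∀ j, (hS.toFinset.filter fun q => min (d q) m = j).card = {q ∈ S | min (d q) m = j}.ncard := by
    intro j
    rw [Set.ncard_eq_toFinset_card _ (hS.subset fun q hq => hq.1)]
    congr 1
    ext q
    simp only [Finset.mem_filter, Set.Finite.mem_toFinset, Set.mem_setOf_eq]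
  have hm' : {q ∈ S | m ≤ d q} = {q ∈ S | min (d q) m = m} := by
    ext q
    simp only [Set.mem_setOf_eq, min_eq_right_iff]
  have hi' : ∀ i, i < m → {q ∈ S | d q = i} = {q ∈ S | min (d q) m = i} := by
    intro i hi
    ext q
    simp only [Set.mem_setOf_eq]
    constructor
    · rintro ⟨hq, h⟩
      exact ⟨hq, by rw [h, min_eq_left hi.le]⟩
    · rintro ⟨hq, h⟩
      refine ⟨hq, ?_⟩
      rcases le_total (d q) m with h' | h'
      · rwa [min_eq_left h'] at h
      · rw [min_eq_right h'] at h
        omega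
  -- regroup
  rw [finsum_mem_eq_finite_toFinset_sum _ hS, Finset.sum_congr rfl (fun q hq => hval q (hS.mem_toFinset.1 hq)),
    Finset.sum_comp (s := hS.toFinset) w (fun q => min (d q) m)]
  have himage : hS.toFinset.image (fun q => min (d q) m) ⊆ Finset.range (m + 1) := fun j hj => by
    obtain ⟨q, -, rfl⟩ := Finset.mem_image.1 hj
    exact Finset.mem_range.2 (Nat.lt_succ_of_le (min_le_right _ _))
  rw [Finset.sum_subset himage (fun j _ hj => by
    rw [Finset.card_eq_zero.2 (Finset.filter_eq_empty_iff.2 fun q hq hb => hj (Finset.mem_image.2 ⟨q, hq, hb⟩)), zero_smul]),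
    Finset.sum_range_succ, add_comm, hfib m, hm']
  congr 1
  exact Finset.sum_congr rfl fun i hi => by rw [hfib i, hi' i (Finset.mem_range.1 hi)]

end Regroup

/-! ## §2 The orbital forms over ★ p843030 -/

section Orbital

variable {G : Type*} [Group G] (γ : G) (K : Subgroup G) {E : Type*} [NormedAddCommGroup E] [NormedSpace ℝ E] [CompleteSpace E]
  [TopologicalSpace G] [IsTopologicalGroup G] [MeasurableSpace G] [BorelSpace G] (ν : Measure G) [ν.IsMulRightInvariant]

/-- **THE DEPTH EXPANSION (generic layer)**: for an open subgroup `K` of finite measure, a right-invariant `ν`, `f` supported in `K` and `K`-conjugation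
invariant, finitely many `γ`-fixed points on `G ⧸ K`, an invariant `d : G ⧸ K → ℕ` («depth») and a cut-off `m` such that the value `f(q.out⁻¹ γ q.out)` at a
fixed point `q` depends only on `min (d q) m` (value law `hval`, weights `w`):
`∫_G f(h γ h⁻¹) dν(h) = ν(K) · ( #{q ∈ Fix | m ≤ d q} · w m + Σ_{i<m} #{q ∈ Fix | d q = i} · w i )` — ★ `integral_conj_eq_smul_finsum_fixedBy` regrouped by §1.
At `U(Φ₂) × U(Φ₁)`, inert `v`: `d` = depth of the `t`-stable vertex lattice, `w m = φ(c•1)`, `w i = φ(N_i(c))` (B-p12 (g29) census 86286e4d §4 display 1; layer 2).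
[cite: Rogawski1990, §4.9 p. 54] [cite: Laumon1995, Lemma (5.3.2) p. 136] [cite: Kottwitz1986, §3] -/
theorem integral_conj_eq_smul_depthExpansion (hK : IsOpen (K : Set G)) (hKν : ν K ≠ ⊤) (f : G → E) (hf : support f ⊆ (K : Set G))
    (hfK : ∀ k ∈ K, ∀ x : G, f (k * x * k⁻¹) = f x) (hfin : (MulAction.fixedBy (G ⧸ K) γ).Finite)
    (d : G ⧸ K → ℕ) (m : ℕ) (w : ℕ → E)
    (hval : ∀ q ∈ MulAction.fixedBy (G ⧸ K) γ, f (q.out⁻¹ * γ * q.out) = w (min (d q) m)) :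
    ∫ g, f (g * γ * g⁻¹) ∂ν =
      ν.real (K : Set G) • ({q ∈ MulAction.fixedBy (G ⧸ K) γ | m ≤ d q}.ncard • w m +
        ∑ i ∈ Finset.range m, {q ∈ MulAction.fixedBy (G ⧸ K) γ | d q = i}.ncard • w i) := by
  rw [integral_conj_eq_smul_finsum_fixedBy γ K ν hK hKν f hf hfK hfin,
    finsum_mem_eq_ncard_smul_add_sum_ncard_smul hfin (fun q : G ⧸ K => f (q.out⁻¹ * γ * q.out)) d m w hval]

/-- **The depth expansion at a CLOSED class with COMPACT centraliser, `K` compact open** (finiteness of the fixed points by ★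
`finite_fixedBy_quotient_of_isClosed`). [cite: Rogawski1990, §4.9 p. 54] [cite: Laumon1995, Lemma (5.3.2) p. 136] -/
theorem integral_conj_eq_smul_depthExpansion_of_isClosed [LocallyCompactSpace G] [SecondCountableTopology G] [T2Space G]
    [IsFiniteMeasureOnCompacts ν] [CompactSpace (Subgroup.centralizer ({γ} : Set G))] (hO : IsClosed {g | ∃ y : G, y * γ * y⁻¹ = g})
    (hK : IsOpen (K : Set G)) (hKc : IsCompact (K : Set G)) (f : G → E) (hf : support f ⊆ (K : Set G))
    (hfK : ∀ k ∈ K, ∀ x : G, f (k * x * k⁻¹) = f x) (d : G ⧸ K → ℕ) (m : ℕ) (w : ℕ → E)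
    (hval : ∀ q ∈ MulAction.fixedBy (G ⧸ K) γ, f (q.out⁻¹ * γ * q.out) = w (min (d q) m)) :
    ∫ g, f (g * γ * g⁻¹) ∂ν =
      ν.real (K : Set G) • ({q ∈ MulAction.fixedBy (G ⧸ K) γ | m ≤ d q}.ncard • w m +
        ∑ i ∈ Finset.range m, {q ∈ MulAction.fixedBy (G ⧸ K) γ | d q = i}.ncard • w i) :=
  integral_conj_eq_smul_depthExpansion γ K ν hK hKc.measure_lt_top.ne f hf hfK
    (finite_fixedBy_quotient_of_isClosed γ K hO hK hKc) d m w hval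

end Orbital

end Literature.NumberTheory.Automorphic

end
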